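import Summits.RiemannHypothesis.RiemannHypothesis.Theses.RuelleBand
import Summits.RiemannHypothesis.RiemannHypothesis.Theses.Strip
import Summits.RiemannHypothesis.RiemannHypothesis.Theorems.AsymptoticCriticalLine.Negative.BandForms
import Literature.Barriers.RiemannHypothesis.DavenportHeilbronn

/-!
# Strategist sketch (crux stmt-RiemannHypothesis-2063 `AsymptoticCriticalLine`, wall-breaker gen 1)

Typed forms of the census attempts (`Cruxes/AsymptoticCriticalLine/STRATEGY-CENSUS.md`, headings Transfer /
Strengthen / Decomposition / Negation; published as `StrategistSketch_g1.lean`).  Nothing here is a line: every statement below is either STRONGER than the crux with no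
tool attached (strengthenings), or a split whose pieces both lack a supplier (decomposition), or an
equivalence decided by the zeros (transfer), or the crux in costume (negation).  The small theorems
are the checks that the typed forms relate to the crux as claimed.
-/

noncomputable section

set_option linter.dupNamespace false

namespace Summit.RiemannHypothesis.RiemannHypothesis.Cruxes.AsymptoticCriticalLine.Strategist

open Set Filter Topology Asymptotics
open Summit.RiemannHypothesis.RiemannHypothesis.Theses.RuelleBand (AsymptoticCriticalLine)
open Summit.RiemannHypothesis.RiemannHypothesis.Theorems.AsymptoticCriticalLine.Negative
  (bandSet acl_iff_bandSet bandSet_finite_iff_bounded)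

/-! ## Strengthen: three `S⁺` and why each is a genuine strengthening -/

/-- `S⁺₁` SUMMABLE DEVIATION (Schatten-`1` rung / Littlewood budget): the deviations `|Re ρ − 1/2|`
of the strip zeros have uniformly bounded finite partial sums. Littlewood–Titchmarsh Thm 9.15:
`2π Σ_{β>σ₀, γ≤T} (β − σ₀) = ∫₀ᵀ log|ζ(σ₀+it)| dt + O(log T)`; at `σ₀ = 1/2` the `O(log T)` boundary
term (`arg ζ`) is exactly what no method controls. -/
def SummableDeviation : Prop :=
  ∃ C : ℝ, ∀ F : Finset ℂ, (∀ s ∈ F, riemannZeta s = 0 ∧ 0 < s.re ∧ s.re < 1) →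
    ∑ s ∈ F, |s.re - 1 / 2| ≤ C

/-- `S⁺₂` HYPERBOLIC TUBE (`|β − 1/2|·|γ|` bounded eventually): the output shape of "self-adjoint +
bounded perturbation in the Casimir variable `(ρ − 1/2)²`". -/
def HyperbolicTube : Prop :=
  ∃ C T₀ : ℝ, ∀ s : ℂ, riemannZeta s = 0 → 0 < s.re → s.re < 1 → T₀ ≤ |s.im| →
    |s.re - 1 / 2| * |s.im| ≤ C

/-- `S⁺₃` EFFECTIVE ACL with an explicit height budget `H`. -/
def EffectiveACL (H : ℝ → ℝ) : Prop :=
  ∀ ε : ℝ, 0 < ε → ∀ s : ℂ, riemannZeta s = 0 → 0 < s.re → s.re < 1 → ε ≤ |s.re - 1 / 2| →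
    |s.im| ≤ H ε

/-- The lemma an induction on scales for `S⁺₃` would need and nobody has: zero-freeness of
`{Re s ≥ σ₀, |Im s| > T}` propagates LEFT by a step `δ(a)` uniform on `[a, 1)`.  False in every
natural deformation class of `ζ` (Epstein / Davenport–Heilbronn: zero-free far right, zeros inside);
for `ζ` unknown and, iterated from de la Vallée Poussin, it would give quasi-RH at every level. -/
def UniformLeftwardPropagation : Prop :=
  ∀ a : ℝ, 1 / 2 < a → ∃ δ : ℝ, 0 < δ ∧ ∀ σ₀ : ℝ, a ≤ σ₀ → σ₀ < 1 →
    (∃ T₀ : ℝ, ∀ s : ℂ, riemannZeta s = 0 → σ₀ ≤ s.re → s.re < 1 → |s.im| ≤ T₀) →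
      ∃ T₁ : ℝ, ∀ s : ℂ, riemannZeta s = 0 → σ₀ - δ ≤ s.re → s.re < 1 → |s.im| ≤ T₁

/-- `S⁺₁ ⟹ crux`: a level-`ε` band with more than `C/ε` elements would break the budget. -/
theorem acl_of_summableDeviation (h : SummableDeviation) : AsymptoticCriticalLine := by
  obtain ⟨C, hC⟩ := h
  rw [acl_iff_bandSet]
  intro ε hε
  by_contra hinf
  have hinf' : (bandSet riemannZeta ε).Infinite := hinf
  obtain ⟨n, hn⟩ : ∃ n : ℕ, C / ε < n := exists_nat_gt (C / ε)
  obtain ⟨F, hFsub, hFcard⟩ := hinf'.exists_subset_card_eq n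
  have hmem : ∀ s ∈ F, riemannZeta s = 0 ∧ 0 < s.re ∧ s.re < 1 := by
    intro s hs
    obtain ⟨hz, h0, h1, _⟩ := hFsub hs
    exact ⟨hz, h0, h1⟩
  have hsum := hC F hmem
  have hlow : (n : ℝ) * ε ≤ ∑ s ∈ F, |s.re - 1 / 2| := by
    have : ∑ s ∈ F, ε ≤ ∑ s ∈ F, |s.re - 1 / 2| :=
      Finset.sum_le_sum fun s hs => (hFsub hs).2.2.2
    simpa [Finset.sum_const, hFcard, nsmul_eq_mul] using this
  have : (n : ℝ) * ε ≤ C := hlow.trans hsum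
  have hn' : C < n * ε := by rwa [div_lt_iff₀ hε] at hn
  linarith

/-- `S⁺₂ ⟹ crux`: under the tube the level-`ε` band has height `≤ max T₀ (C/ε)`. -/
theorem acl_of_hyperbolicTube (h : HyperbolicTube) : AsymptoticCriticalLine := by
  obtain ⟨C, T₀, hC⟩ := h
  rw [acl_iff_bandSet]
  intro ε hε
  rw [bandSet_finite_iff_bounded]
  refine ⟨max T₀ (C / ε), fun s hs => ?_⟩
  obtain ⟨hz, h0, h1, hε'⟩ := hs
  by_cases hT : T₀ ≤ |s.im|
  · have hb := hC s hz h0 h1 hT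
    have : ε * |s.im| ≤ C := le_trans (mul_le_mul_of_nonneg_right hε' (abs_nonneg _)) hb
    have : |s.im| ≤ C / ε := by rw [le_div_iff₀ hε]; linarith
    exact this.trans (le_max_right _ _)
  · exact (le_of_lt (not_le.1 hT)).trans (le_max_left _ _)

/-- `S⁺₃ ⟹ crux`. -/
theorem acl_of_effectiveACL {H : ℝ → ℝ} (h : EffectiveACL H) : AsymptoticCriticalLine := by
  rw [acl_iff_bandSet]
  intro ε hε
  rw [bandSet_finite_iff_bounded]
  exact ⟨H ε, fun s hs => h ε hε s hs.1 hs.2.1 hs.2.2.1 hs.2.2.2⟩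

/-! ## Decomposition with slack (not lossless): sub-logarithmic count ∧ off-line breeding -/

/-- The level-`ε` band truncated at height `T`. -/
def bandUpTo (ε T : ℝ) : Set ℂ :=
  {s : ℂ | s ∈ bandSet riemannZeta ε ∧ |s.im| ≤ T}

/-- `Sub₁` SUB-LOGARITHMIC COUNT: `N_band(ε, T) ≤ C(ε) log log T` — between every density theorem
(`T^{1−cε}`) and the crux (`O(1)`); already ⟹ Backlund ⟹ Lindelöf; no supplier (W1). Junk-free:
finiteness is part of the statement (a covering finset). -/
def SubLogCount : Prop :=
  ∀ ε : ℝ, 0 < ε → ∃ C : ℝ, ∀ T : ℝ, 3 ≤ T →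
    ∃ G : Finset ℂ, bandUpTo ε T ⊆ ↑G ∧ (G.card : ℝ) ≤ C * Real.log (Real.log T)

/-- `Sub₂` OFF-LINE BREEDING: an infinite level-`ε` band forces `≥ c log T` zeros in the
level-`ε/2` band below height `T` for arbitrarily large `T`.  A ZOI-type propagation statement
(one far zero breeds many); the only breeding mechanism known (Bagchi–Rouché recurrence) breeds
`cT` zeros and is therefore excluded by density theorems — no supplier. -/
def OffLineBreeding : Prop :=
  ∀ ε : ℝ, 0 < ε → (bandSet riemannZeta ε).Infinite →
    ∃ c : ℝ, 0 < c ∧ ∃ᶠ T in atTop, ∃ F : Finset ℂ, ↑F ⊆ bandUpTo (ε / 2) T ∧ c * Real.log T ≤ F.card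

/-- GLUE of the slack split: `Sub₁ → Sub₂ → crux` (`log log T = o(log T)`). -/
theorem acl_of_subLogCount_of_breeding (h1 : SubLogCount) (h2 : OffLineBreeding) :
    AsymptoticCriticalLine := by
  rw [acl_iff_bandSet]
  intro ε hε
  by_contra hinf
  obtain ⟨c, hc, hfreq⟩ := h2 ε hε hinf
  obtain ⟨C, hC⟩ := h1 (ε / 2) (half_pos hε)
  set C' : ℝ := max C 1 with hC'
  have hC'pos : 0 < C' := lt_of_lt_of_le one_pos (le_max_right _ _)
  -- `log log T ≤ (c / (2 C')) · log T` eventually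
  have hlo : (fun T : ℝ => Real.log (Real.log T)) =o[atTop] fun T : ℝ => Real.log T :=
    Real.isLittleO_log_id_atTop.comp_tendsto Real.tendsto_log_atTop
  have hev1 : ∀ᶠ T : ℝ in atTop, ‖Real.log (Real.log T)‖ ≤ c / (2 * C') * ‖Real.log T‖ :=
    hlo.bound (by positivity)
  have hev2 : ∀ᶠ T : ℝ in atTop, (3 : ℝ) ≤ T := eventually_ge_atTop 3
  obtain ⟨T, ⟨F, hFsub, hFcard⟩, hT1, hT3⟩ := (hfreq.and_eventually (hev1.and hev2)).exists
  obtain ⟨G, hGsup, hGcard⟩ := hC T hT3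
  have hlogT : 0 < Real.log T := Real.log_pos (by linarith)
  have hloglog : 0 ≤ Real.log (Real.log T) := by
    apply Real.log_nonneg
    have : Real.log (Real.exp 1) ≤ Real.log T :=
      Real.log_le_log (Real.exp_pos 1) (by linarith [Real.exp_one_lt_d9.le.trans (by norm_num : (2.7182818286 : ℝ) ≤ 3)])
    simpa using this
  have hFG : F ⊆ G := by
    intro s hs
    have : (s : ℂ) ∈ bandUpTo (ε / 2) T := hFsub (Finset.mem_coe.2 hs)
    exact Finset.mem_coe.1 (hGsup this)
  have hcard : (F.card : ℝ) ≤ G.card := by exact_mod_cast Finset.card_le_card hFG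
  have h1' : (G.card : ℝ) ≤ C' * Real.log (Real.log T) :=
    hGcard.trans (mul_le_mul_of_nonneg_right (le_max_left _ _) hloglog)
  have h2' : C' * Real.log (Real.log T) ≤ c / 2 * Real.log T := by
    have := hT1
    rw [Real.norm_of_nonneg hloglog, Real.norm_of_nonneg hlogT.le] at this
    have := mul_le_mul_of_nonneg_left this hC'pos.le
    calc C' * Real.log (Real.log T) ≤ C' * (c / (2 * C') * Real.log T) := this
      _ = c / 2 * Real.log T := by field_simp
  have : c * Real.log T ≤ c / 2 * Real.log T := hFcard.trans (hcard.trans (h1'.trans h2'))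
  nlinarith

/-! ## Transfer (reformulation): Bagchi recurrence, eventual and one-sided -/

/-- EVENTUAL RIGHT-RECURRENCE at offset `ε`: every patch of `ζ` of radius `ε` centred on the
segment `1/2 + 2ε ≤ Re z ≤ 1 − 2ε` at a large height recurs under vertical shifts with positive
lower density.  Steuding 2006 Thm 8.3 is the `θ`-version (quasi-RH(θ) ⟺ recurrence of all patches
right of `θ`).  The eventual version is decided patch by patch by the zeros: ⟸ by Voronin
universality (a zero-free patch is an admissible target), ⟹ by Rouché + Bohr–Landau density (a
recurrent patch with a zero breeds `cT` zeros).  NOTE THE REACH: the patches live in the closed slab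
`1/2 + ε ≤ Re s ≤ 1 − ε`; universality cannot leave the open strip, so the language sees only the
INTERIOR slab — the edge `[1 − ε, 1)` (Strip's crux) is out of its reach, exactly as for every band
mechanism (crux NOTES C2).  A dictionary for the interior half, not an engine. -/
def EventualRightRecurrence (ε : ℝ) : Prop :=
  ∃ T₀ : ℝ, ∀ z : ℂ, 1 / 2 + 2 * ε ≤ z.re → z.re ≤ 1 - 2 * ε → T₀ ≤ |z.im| → ∀ δ : ℝ, 0 < δ →
    0 < liminf (fun T : ℝ => (MeasureTheory.volume {τ : ℝ | τ ∈ Icc (0 : ℝ) T ∧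
      ∀ s : ℂ, ‖s - z‖ ≤ ε → ‖riemannZeta (s + τ * Complex.I) - riemannZeta s‖ < δ}).toReal / T) atTop

/-- Zeros of `ζ` in the closed interior slab `1/2 + ε ≤ Re s ≤ 1 − ε`. -/
def slabZeros (ε : ℝ) : Set ℂ :=
  {s : ℂ | riemannZeta s = 0 ∧ 1 / 2 + ε ≤ s.re ∧ s.re ≤ 1 - ε}

/-- The dictionary entry it would supply (stated, not proved here; both implications are theorems
of universality / density type — Steuding 2006 Thm 8.3 eventualised — with the usual open/closed
margin): finiteness of the closed `ε`-slab gives recurrence at offset `ε`, and recurrence at offset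
`ε` gives finiteness of every narrower closed slab.  Neither direction touches the edge. -/
def BagchiEventualDichotomy : Prop :=
  ∀ ε : ℝ, 0 < ε → ε < 1 / 8 →
    ((slabZeros ε).Finite → EventualRightRecurrence ε) ∧
      (EventualRightRecurrence ε → ∀ ε' : ℝ, ε < ε' → (slabZeros ε').Finite)

/-! ## Negation: the obstruction to a counterexample is Hamburger rigidity, which is zero-blind -/

/-- "Every member of Hamburger's class has the band shape": the class is `{C ζ}` by the in-tree
theorem `Literature.Barriers.RiemannHypothesis.Hamburger_holds`, so this typed obstruction is the
crux in costume (for `a 1 ≠ 0`) and vacuous otherwise — rigidity of the OBJECT carries no zero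
information. -/
def HamburgerClassBand : Prop :=
  ∀ (a b : ℕ → ℂ) (G : ℂ → ℂ) (P : Polynomial ℂ) (α : ℝ), 0 < α →
    Differentiable ℂ G →
    (∃ A B : ℝ, ∀ s : ℂ, ‖G s‖ ≤ A * Real.exp (‖s‖ ^ B)) →
    P ≠ 0 →
    (∀ s : ℂ, 1 < s.re → LSeriesSummable a s ∧ P.eval s * LSeries a s = G s) →
    (∀ s : ℂ, s.re < -α → LSeriesSummable b (1 - s)) →
    (∀ s : ℂ, s.re < -α → P.eval s ≠ 0 → (∀ n : ℕ, s ≠ -(2 * (n : ℂ))) →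
      G s / P.eval s * Complex.Gamma (s / 2) * (Real.pi : ℂ) ^ (-s / 2) =
        LSeries b (1 - s) * Complex.Gamma (1 / 2 - s / 2) * (Real.pi : ℂ) ^ (-(1 - s) / 2)) →
    a 1 ≠ 0 → ∀ ε : ℝ, 0 < ε → (bandSet (fun s => G s / P.eval s) ε).Finite

end Summit.RiemannHypothesis.RiemannHypothesis.Cruxes.AsymptoticCriticalLine.Strategist
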